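import Summits.CriticalPhenomena.SAWScalingLimit.Theses.SAWDiscreteFlowLine

/-!
# Birth skeleton (`Lines/birth.lean`, BC3) for the crux `GaussianDressing` of route `SAWDiscreteFlowLine`
(item stmt-CriticalPhenomena-8242, rank 4, sub-problem `SAWScalingLimit`)

Crux (`Summit.CriticalPhenomena.SAWScalingLimit.Theses.SAWDiscreteFlowLine.GaussianDressing`, "(G)"): for every
Dobrushin domain `(D; a, b)`, endpoint approximation `(a_δ, b_δ)` and chordal uniformizer `φ` there are kernels
`K_δ(γ; dh)` on `(critical SAW γ of Ω_δ from a_δ to b_δ) × (fields h on the faces)` with first marginal `SAW.law`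
and field marginal EXACTLY the face DGFF of `Ω_δ` (the `gff` clause = `IsFaceDGFFLaw`), under which `γ` DRESSES THE
FIELD WELL: for every test function `ψ ∈ C_c(D)` and `s ∈ ℝ` the progressive dressing defect
`dft_δ = sup_{k, |F| ≤ 1} |E[F(γ^k) (e^{i s κ₀⟨h,ψ⟩_δ} − M_δ(γ^k))]| → 0` as `δ → 0⁺`, where `γ^k = (i ↦ γ(i ∧ k))` is the
frozen prefix, `κ₀ = √(π/2)`, and `M_δ(v) = exp(i s ⟨U^v, ψ⟩_δ − s²(π/2)⟨ψ, G_{Fc_δ ∖ K v} ψ⟩_δ / 2)` is the characteristic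
function of the Gaussian "dressed by `v`": mean = the flow-line dressing `U^v` (discrete-harmonic extension into the
slit face-domain of the `κ = 8/3` imaginary-geometry data `∓λ′ + χ(α_ℍ − π/2) − λ + (2λ/π) Arg φ⁻¹`), covariance = the
killed-walk Green function of the slit face-domain.

## The line (`birth`) = the route header's own two-layer plan for (G), typed

Route header, TWO-LAYER PLAN: "GaussianDressing ⇐ FlowLineMeanValue (sibling card, law form) → DomainMarkovUpgrade
(exact SAW domain Markov + Gaussian closure of the dressed mixture) → GaussianDressing".  The cut used here is the one
forced by the defect functional itself.  OBSERVATION (proved on paper in `Lines/birth.md` §2, ten lines): under ANY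
coupling as in (G), comparing the defect at `(k, F)` with the defect at `(k′ ≥ max |γ|, F ∘ (·)^k)` gives
`|E_SAW[F(γ^k) (M_δ(γ) − M_δ(γ^k))]| ≤ 2·dft_δ`; so (G) forces the FIELD-FREE statement

* `stub_sawDressingMartingale` (**SAWDressingMartingale**, the HEART, open-problem size): under the critical SAW law
  alone, the dressing functional `k ↦ M_δ(γ^k)` is an approximate martingale of the walk's own filtration, uniformly:
  `mdf_δ(ψ, s) := sup_{k, |F| ≤ 1} |∫ F(γ^k) (M_δ(γ) − M_δ(γ^k)) dSAW.law(γ)| → 0` for every `ψ ∈ C_c(D)`, `s ∈ ℝ`.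
  In words: averaged over the critical polymer, "the Gaussian dressed by the whole polymer, seen from any prefix, is the
  Gaussian dressed by the prefix" — the lattice form of the Miller–Sheffield flow-line martingale characterisation
  (IG-I Thm 1.1 ⇐ Prop. 3.4-type martingales) at `κ = 8/3`, `χ = 1/√6`; at `k = 0` (empty prefix: `U ≡ 0`, full Green
  function) it says that the DRESSED MIXTURE `Σ_γ P_δ(γ) N(U^γ, (π/2) G_{slit γ})` has asymptotically the face-DGFF
  characteristic functional ("Gaussian closure").  No field, no coupling: pure SAW + discrete potential theory.  This
  is where the conjunct-strength content of (G) lives (why it might fail = the crux's: no lattice identity makes the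
  `ℤ²` SAW a flow line — barrier `NienhuisWeightsExcludeVertexSAW`, evaded as in the route header because the statement
  is asymptotic and averaged; the `√δ`-block winding convention may bias `U` near the fractal tip).

* `stub_dressedCouplingUpgrade` (**DressedCouplingUpgrade**, L): for each `(D; a, b), (a_δ, b_δ), φ`: the
  approximate martingale property above ⟹ the conclusion of (G) (a well-dressing coupling with EXACT face-DGFF
  marginal).  Gaussian / functional-analytic technology, no SAW input beyond the hypothesis: (1) the dressed fibres
  `N_γ = N(U^γ/κ₀, G_{Fc_δ∖Kγ})` exist (killed-walk Green functions are positive semi-definite) and the dressed mixture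
  `h″ := U^γ/κ₀ + h̃_γ` has `E[F(γ^k) e^{isκ₀⟨h″,ψ⟩}] = E[F(γ^k) M_δ(γ)]` EXACTLY, hence dresses well by the hypothesis and
  has asymptotically-DGFF pairings (hypothesis at `k = 0`; joint finite-dimensional laws by linearity in `ψ`);
  (2) per-`ψ` tightness of `⟨U^γ, ψ⟩_δ` under `SAW.law` follows from the `k = 0` identity for all `s` (average in `s`
  over `[-τ, τ]`); (3) Prokhorov + Strassen in `ℝ^ℕ` over a countable dense family of test functions give, for each
  `δ`, a coupling of `h″` with an exact face-DGFF sample `h` (`faceDGFF`, landed) with `⟨h″ − h, ψ_j⟩_δ → 0` in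
  probability for every `j`; (4) all `ψ ∈ C_c(D)` by the Banach–Steinhaus theorem in the F-space of uniformly tight
  families (linear maps `C₀(K) → L⁰`, pointwise bounded by (2)) plus the uniform `L²` bound `⟨η, G_δ η⟩_δ ≤ C‖η‖²` for the
  Gaussian parts; (5) `K_δ(γ; ·) := P_δ(γ)·(law of h given γ)` (finitely many `γ`: `finite_domainSAW_of_isBounded`) has
  the two exact marginals and `|dft_δ(K) − (defect of h″)| ≤ sup E|e^{isκ₀⟨h−h″,ψ⟩_δ} − 1| → 0`.  Why it might fail: only
  through (4) — if per-`ψ` control could not be made joint the upgrade would need an extra a-priori bound on the local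
  `L¹` mass of the winding dressing `U^{γ^k}` under `SAW.law` (mesoscopic spiral proliferation; deterministic paths DO
  violate it, so the bound must be probabilistic) — which would then be filed `--supports` this stub, not a new item.

Both stubs are CONSEQUENCES of (G) ((G) ⇒ martingale property by the observation; (G) ⇒ upgrade trivially), so the
stub set is logically equivalent to the crux: the cut loses nothing, it separates the SAW identity from the coupling
technology.  Composition `GaussianDressing_of` (PROVED below, no `sorry`): pointwise in `(D, a, b, φ)`, modus ponens —
the two named statements are stated over the crux's OWN `let` telescope, letter for letter (generated from the ledger
signature of stmt-CriticalPhenomena-8242), extended by the two lets `M` (dressed characteristic function; the crux's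
`dfc δ ψ s v h = exp(i s κ₀ pr_δ ψ h) − M δ ψ s v`) and `mdf` (martingale defect), so the conclusion is the route decl BY
NAME by definitional unfolding only.

Disproof.lean: none exists for this crux (`ledger crux ls stmt-CriticalPhenomena-8242`: no workfiles before this one;
no `_false_without_` theorems, no landed `Negative/` lemmas); negatives index (`ledger negatives --problem
CriticalPhenomena`): no entry is a statement about `SAW.law` dressing a Gaussian field (the all-δ tightness negative
stmt-CriticalPhenomena-0772 is not touched: every clause here is eventual / `Tendsto` at `0⁺`).  Hypotheses honoured:
`IsEndpointApprox` (reachability ⇒ `SAW.law` is eventually a probability law, used in (5)) and `IsChordalUniformizing φ`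
(enters `U` through `pt`, `ang`, `dat`) are threaded verbatim through both stubs.

Sources: MillerSheffield2016 (IG-I, arXiv:1201.1496) Thm 1.1–1.2 and §3 (flow-line martingales); Dubedat2009 (SLE/GFF
coupling via martingale characterisation); SchrammSheffield2010 (arXiv:1008.2447) §1.3; LawlerSchrammWerner2004SAW
§3.4.2 / Prediction 1; Billingsley1999 Thm 3.1 and §6 (Prokhorov, Strassen–Dudley coupling); Rudin, Functional Analysis
Thm 2.6 (Banach–Steinhaus for F-spaces); tree (namespace `Literature.Probability.RandomPlanarGeometry`):
`FaceDGFF.lean` / `FaceDGFFLaw.lean` (`IsFaceDGFFLaw` = the `gff` clause, `faceDGFF`, `isFaceDGFFLaw_faceDGFF`,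
`isProbabilityMeasure_faceDGFF`, `faceDomain_finite`), `SAW.finite_domainSAW` (DiagonalDressedSAW.lean), `SAW.law`,
`SAW.DomainSAW.measurable_of_top`.

## BC3 certificate (planner-skel-stmt-CriticalPhenomena-8242-0, 2026-08-17)

* `lean check --json birth.lean`: rc 0, errors [], sorries 2 = exactly the two `stub_*` theorems
  (`stub_sawDressingMartingale`, `stub_dressedCouplingUpgrade`), zero `sorry` elsewhere; `GaussianDressing_of` and the
  closing `example` are kernel-checked and conclude `Theses.SAWDiscreteFlowLine.GaussianDressing` BY NAME.
* Probes (folder `bc/<Stub>_probe_{crux,summit}[_split].lean`: this file's § 1 `def <Stub>` verbatim, importing only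
  the route file, then `set_option maxHeartbeats 400000 in example : <Stub> → <Target> := by <tac>` with
  `<Target> ∈ {Theses.SAWDiscreteFlowLine.GaussianDressing, _root_.SAWScalingLimit}`): ALL FAIL, for both stubs and both
  targets — combined form `first | exact? | simpa [<Stub>] | (unfold <Stub>; simpa) | aesop`: rc 1 (4/4); per
  alternative (16/16 fail): `exact?` → "`exact?` could not close the goal"; `simpa [<Stub>]` and
  `unfold <Stub>; simpa` → deterministic timeout at `whnf` (400000 heartbeats) without closing the goal; `aesop` →
  "failed to prove the goal after exhaustive search", unsolved `a : <Stub> ⊢ GaussianDressing` / `⊢ SAWScalingLimit`.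
  No stub is cheaply the crux or the summit (wall 54–119 s per file on the farm).
* Vacuity pass: `mdf` is the `sSup` of a nonempty subset of `[0, 2]` (bounded integrand `|F| ≤ 1`, `|M| ≤ 1` since the
  killed-walk quadratic form `Qv ≥ 0`, over the finite measure `SAW.law` on the finite discrete type `DomainSAW`, so the
  Bochner integral is a finite sum — no junk `0`); at `k = 0` the prefix is the constant path, `K = ∅`, `U ≡ 0`, and the
  stub demands `E_SAW[M_δ(γ)] → exp(−s²(π/2)Q_{Fc}(ψ)/2)` — genuinely open, exactly the crux's own risk, not vacuous.
-/

noncomputable section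

namespace Summit.CriticalPhenomena.SAWScalingLimit.Cruxes.GaussianDressing.Birth

open scoped BigOperators Topology Manifold Classical MeasureTheory ProbabilityTheory Matrix InnerProductSpace ComplexConjugate ContinuousMap
open Filter Set Function TopologicalSpace MeasureTheory

/-! ## 1. The two statements of the line (named forms, over the crux's own `let` telescope) -/

set_option linter.unusedVariables false in
/-- **SAWDressingMartingale** (stub 1, the heart; field-free).  For every Dobrushin domain, endpoint approximation and
chordal uniformizer, with the crux's vocabulary (`Fc, Gf, Hm, K, U, pr, Qv, …` verbatim) and
`M δ ψ s v := exp(i s ⟨U^v, ψ⟩_δ − s² (π/2) ⟨ψ, G_{Fc δ ∖ K v} ψ⟩_δ / 2)` (so that the crux's `dfc δ ψ s v h` is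
`exp(i s κ₀ ⟨h, ψ⟩_δ) − M δ ψ s v`): the martingale defect
`mdf δ ψ s := sup_{k, |F| ≤ 1} ‖∫ F(γ^k) · (M δ ψ s γ − M δ ψ s γ^k) dSAW.law(γ)‖`, `γ^k := (i ↦ γ.walk.getVert (i ∧ k))`,
tends to `0` as `δ → 0⁺`, for every continuous compactly supported `ψ` with `tsupport ψ ⊆ D` and every `s : ℝ`.
(Bounded integrands over a finite measure; the `sSup` set is a nonempty subset of `[0, 2]`: no junk.)
[cite: MillerSheffield2016, Thm 1.1 and §3] [cite: Dubedat2009] [cite: LawlerSchrammWerner2004SAW, Prediction 1] -/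
def SAWDressingMartingale : Prop :=
    ∀ (D : Literature.Probability.RandomPlanarGeometry.DobrushinDomain) a b,
      Literature.Probability.RandomPlanarGeometry.SAW.IsEndpointApprox D a b → ∀ φ, D.IsChordalUniformizing φ
      → let S : Type := Literature.Probability.LatticeModels.Site 2;
    let pi := Real.pi;
    let sq := Real.sqrt;
    let I := Complex.I;
    let ex := Complex.exp;
    let ar := Complex.arg;
    let mp := Literature.Probability.LatticeModels.meshPoint;
    let Ad := fun δ (x y : S) => (Literature.Probability.LatticeModels.discreteDomainGraph D.carrier δ).Adj x y;
    let Fc := fun δ => {f : S | Ad δ f (f + ![1,0]) ∧ Ad δ f (f + ![0,1]) ∧ Ad δ (f + ![1,0]) (f + ![1,1]) ∧ Ad δ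
      (f + ![0,1]) (f + ![1,1])};
    let ctr := fun δ f => mp δ f + (δ : ℂ) * (1 + I) / 2;
    let Gf := fun (A : Set S) f g => ∑' ω : (Literature.Probability.LatticeModels.zdGraph 2).Walk f g, if (∀ x ∈
      ω.support, x ∈ A) then ((4 : ℝ)⁻¹) ^ ω.length else 0;
    let Hm := fun A (z f : S) => (Gf A z (f + ![1,0]) + Gf A z (f + ![-1,0]) + Gf A z (f + ![0,1]) + Gf A z (f +
      ![0,-1])) / 4;
    let lf := fun (x y : S) => if y = x + ![1,0] then x else if y = x + ![0,1] then x + ![-1,0] else if y = x +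
      ![-1,0] then x + ![-1,-1] else x + ![0,-1];
    let rf := fun (x y : S) => if y = x + ![1,0] then x + ![0,-1] else if y = x + ![0,1] then x else if y = x +
      ![-1,0] then x + ![-1,0] else x + ![-1,-1];
    let Ed := fun (v : ℕ → S) i f => v (i + 1) ≠ v i ∧ (f = lf (v i) (v (i + 1)) ∨ f = rf (v i) (v (i + 1)));
    let K := fun v => {f | ∃ i, Ed v i f};
    let jf := fun v f => sInf {i | Ed v i f};
    let bl := fun (δ : ℝ) => ⌈(sq δ)⁻¹⌉₊;
    let pt := fun δ (v : ℕ → S) i => φ.symm (mp δ (v (bl δ * i)));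
    let ang := fun δ v B => pi / 2 + ar ((pt δ v 1 - pt δ v 0) / I) + ∑ i ∈ Finset.range B, ar ((pt δ v (i + 2) -
      pt δ v (i + 1)) / (pt δ v (i + 1) - pt δ v i));
    let dat := fun δ v f => (if f = lf (v (jf v f)) (v (jf v f + 1)) then -1 else 1) * (pi / sq 6) + (1 / sq 6) *
      (ang δ v (jf v f / bl δ) - pi / 2) - pi * sq (3 / 8) + 2 * sq (3 / 8) * ar (φ.symm (ctr δ f));
    let U := fun δ v z => ∑' f : S, if f ∈ K v then Hm (Fc δ \ K v) z f * dat δ v f else 0;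
    let pr := fun (δ : ℝ) (ψ : ℂ → ℝ) (w : S → ℝ) => ∑' f : S, if f ∈ Fc δ then δ ^ 2 * ψ (ctr δ f) * w f else 0;
    let Qv := fun (δ : ℝ) (ψ : ℂ → ℝ) (A : Set S) => ∑' f : S, ∑' g : S, if f ∈ Fc δ ∧ g ∈ Fc δ then δ ^ 4 * ψ
      (ctr δ f) * ψ (ctr δ g) * Gf A f g else 0;
    let gff := fun (δ : ℝ) (μ : Measure (S → ℝ)) => IsProbabilityMeasure μ ∧ ∀ t : S →₀ ℝ, ∫ h, ex (I * ((∑ f ∈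
      t.support, t f * h f : ℝ) : ℂ)) ∂μ = ex (-((∑ f ∈ t.support, ∑ g ∈ t.support, t f * t g * Gf (Fc δ) f g
      : ℝ) : ℂ) / 2);
    let dfc := fun δ ψ s v h => ex (I * (s * sq (pi / 2) * pr δ ψ h : ℝ)) - ex (I * (s * pr δ ψ (U δ v) : ℝ) - ((s
      ^ 2 * (pi / 2) * Qv δ ψ (Fc δ \ K v) / 2 : ℝ) : ℂ));
    let dft := fun δ ψ s (ι : Type) (pre : ι → ℕ → ℕ → S) (Kr : ι → Measure (S → ℝ)) => sSup {r : ℝ | ∃ (k : ℕ) (F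
      : (ℕ → S) → ℝ), (∀ v, |F v| ≤ 1) ∧ r = ‖∑' ξ : ι, ∫ h, (F (pre ξ k) : ℂ) * dfc δ ψ s (pre ξ k) h ∂(Kr
      ξ)‖};
    let M := fun δ ψ s v => ex (I * (s * pr δ ψ (U δ v) : ℝ) - ((s ^ 2 * (pi / 2) * Qv δ ψ (Fc δ \ K v) / 2 : ℝ) :
      ℂ));
    let mdf := fun (δ : ℝ) (ψ : ℂ → ℝ) (s : ℝ) => sSup {r : ℝ | ∃ (k : ℕ) (F : (ℕ → S) → ℝ), (∀ v, |F v| ≤ 1) ∧ r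
      = ‖∫ γ, (F (fun i => γ.walk.getVert (min i k)) : ℂ) * (M δ ψ s (fun i => γ.walk.getVert i) - M δ ψ s
      (fun i => γ.walk.getVert (min i k))) ∂(Literature.Probability.RandomPlanarGeometry.SAW.law D.carrier δ
      (a δ) (b δ))‖}; ∀ (ψ : ℂ → ℝ) s, Continuous ψ → HasCompactSupport ψ → tsupport ψ ⊆ D.carrier → Tendsto
      (fun δ => mdf δ ψ s) (𝓝[>] 0) (𝓝 0)

/-- **DressedCouplingUpgrade** (stub 2, L).  For every Dobrushin domain, endpoint approximation and chordal
uniformizer: IF the martingale defect of stub 1 tends to `0` for all test data `(ψ, s)`, THEN the conclusion of the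
crux holds there — kernels `Kr δ : DomainSAW → Measure (faces → ℝ)` with first marginal `SAW.law`, total field
marginal exactly the face DGFF (`gff`), and progressive dressing defect `dft → 0`.  (Dressed Gaussian mixture
`U^γ/κ₀ + h̃_γ`; Prokhorov–Strassen coupling to an exact DGFF sample on a countable family of test functions;
Banach–Steinhaus for the rest; see the module docstring.)  The text after the hypothesis is the crux's body verbatim.
[cite: Billingsley1999, Thm 3.1 and §6] [cite: MillerSheffield2016, Thm 1.1] -/
def DressedCouplingUpgrade : Prop :=
    ∀ (D : Literature.Probability.RandomPlanarGeometry.DobrushinDomain) a b,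
      Literature.Probability.RandomPlanarGeometry.SAW.IsEndpointApprox D a b → ∀ φ, D.IsChordalUniformizing φ
      → let S : Type := Literature.Probability.LatticeModels.Site 2;
    let pi := Real.pi;
    let sq := Real.sqrt;
    let I := Complex.I;
    let ex := Complex.exp;
    let ar := Complex.arg;
    let mp := Literature.Probability.LatticeModels.meshPoint;
    let Ad := fun δ (x y : S) => (Literature.Probability.LatticeModels.discreteDomainGraph D.carrier δ).Adj x y;
    let Fc := fun δ => {f : S | Ad δ f (f + ![1,0]) ∧ Ad δ f (f + ![0,1]) ∧ Ad δ (f + ![1,0]) (f + ![1,1]) ∧ Ad δ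
      (f + ![0,1]) (f + ![1,1])};
    let ctr := fun δ f => mp δ f + (δ : ℂ) * (1 + I) / 2;
    let Gf := fun (A : Set S) f g => ∑' ω : (Literature.Probability.LatticeModels.zdGraph 2).Walk f g, if (∀ x ∈
      ω.support, x ∈ A) then ((4 : ℝ)⁻¹) ^ ω.length else 0;
    let Hm := fun A (z f : S) => (Gf A z (f + ![1,0]) + Gf A z (f + ![-1,0]) + Gf A z (f + ![0,1]) + Gf A z (f +
      ![0,-1])) / 4;
    let lf := fun (x y : S) => if y = x + ![1,0] then x else if y = x + ![0,1] then x + ![-1,0] else if y = x +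
      ![-1,0] then x + ![-1,-1] else x + ![0,-1];
    let rf := fun (x y : S) => if y = x + ![1,0] then x + ![0,-1] else if y = x + ![0,1] then x else if y = x +
      ![-1,0] then x + ![-1,0] else x + ![-1,-1];
    let Ed := fun (v : ℕ → S) i f => v (i + 1) ≠ v i ∧ (f = lf (v i) (v (i + 1)) ∨ f = rf (v i) (v (i + 1)));
    let K := fun v => {f | ∃ i, Ed v i f};
    let jf := fun v f => sInf {i | Ed v i f};
    let bl := fun (δ : ℝ) => ⌈(sq δ)⁻¹⌉₊;
    let pt := fun δ (v : ℕ → S) i => φ.symm (mp δ (v (bl δ * i)));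
    let ang := fun δ v B => pi / 2 + ar ((pt δ v 1 - pt δ v 0) / I) + ∑ i ∈ Finset.range B, ar ((pt δ v (i + 2) -
      pt δ v (i + 1)) / (pt δ v (i + 1) - pt δ v i));
    let dat := fun δ v f => (if f = lf (v (jf v f)) (v (jf v f + 1)) then -1 else 1) * (pi / sq 6) + (1 / sq 6) *
      (ang δ v (jf v f / bl δ) - pi / 2) - pi * sq (3 / 8) + 2 * sq (3 / 8) * ar (φ.symm (ctr δ f));
    let U := fun δ v z => ∑' f : S, if f ∈ K v then Hm (Fc δ \ K v) z f * dat δ v f else 0;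
    let pr := fun (δ : ℝ) (ψ : ℂ → ℝ) (w : S → ℝ) => ∑' f : S, if f ∈ Fc δ then δ ^ 2 * ψ (ctr δ f) * w f else 0;
    let Qv := fun (δ : ℝ) (ψ : ℂ → ℝ) (A : Set S) => ∑' f : S, ∑' g : S, if f ∈ Fc δ ∧ g ∈ Fc δ then δ ^ 4 * ψ
      (ctr δ f) * ψ (ctr δ g) * Gf A f g else 0;
    let gff := fun (δ : ℝ) (μ : Measure (S → ℝ)) => IsProbabilityMeasure μ ∧ ∀ t : S →₀ ℝ, ∫ h, ex (I * ((∑ f ∈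
      t.support, t f * h f : ℝ) : ℂ)) ∂μ = ex (-((∑ f ∈ t.support, ∑ g ∈ t.support, t f * t g * Gf (Fc δ) f g
      : ℝ) : ℂ) / 2);
    let dfc := fun δ ψ s v h => ex (I * (s * sq (pi / 2) * pr δ ψ h : ℝ)) - ex (I * (s * pr δ ψ (U δ v) : ℝ) - ((s
      ^ 2 * (pi / 2) * Qv δ ψ (Fc δ \ K v) / 2 : ℝ) : ℂ));
    let dft := fun δ ψ s (ι : Type) (pre : ι → ℕ → ℕ → S) (Kr : ι → Measure (S → ℝ)) => sSup {r : ℝ | ∃ (k : ℕ) (F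
      : (ℕ → S) → ℝ), (∀ v, |F v| ≤ 1) ∧ r = ‖∑' ξ : ι, ∫ h, (F (pre ξ k) : ℂ) * dfc δ ψ s (pre ξ k) h ∂(Kr
      ξ)‖};
    let M := fun δ ψ s v => ex (I * (s * pr δ ψ (U δ v) : ℝ) - ((s ^ 2 * (pi / 2) * Qv δ ψ (Fc δ \ K v) / 2 : ℝ) :
      ℂ));
    let mdf := fun (δ : ℝ) (ψ : ℂ → ℝ) (s : ℝ) => sSup {r : ℝ | ∃ (k : ℕ) (F : (ℕ → S) → ℝ), (∀ v, |F v| ≤ 1) ∧ r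
      = ‖∫ γ, (F (fun i => γ.walk.getVert (min i k)) : ℂ) * (M δ ψ s (fun i => γ.walk.getVert i) - M δ ψ s
      (fun i => γ.walk.getVert (min i k))) ∂(Literature.Probability.RandomPlanarGeometry.SAW.law D.carrier δ
      (a δ) (b δ))‖}; (∀ (ψ : ℂ → ℝ) s, Continuous ψ → HasCompactSupport ψ → tsupport ψ ⊆ D.carrier → Tendsto
      (fun δ => mdf δ ψ s) (𝓝[>] 0) (𝓝 0)) → ∃ Kr : (δ : ℝ) →
      Literature.Probability.RandomPlanarGeometry.SAW.DomainSAW D.carrier δ (a δ) (b δ) → Measure (S → ℝ), (∀ᶠ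
      δ in (𝓝[>] 0), (∀ γ, Kr δ γ univ = Literature.Probability.RandomPlanarGeometry.SAW.law D.carrier δ (a δ)
      (b δ) {γ}) ∧ gff δ (Measure.sum (Kr δ))) ∧ ∀ (ψ : ℂ → ℝ) s, Continuous ψ → HasCompactSupport ψ →
      tsupport ψ ⊆ D.carrier → Tendsto (fun δ => dft δ ψ s
      (Literature.Probability.RandomPlanarGeometry.SAW.DomainSAW D.carrier δ (a δ) (b δ)) (fun γ k i =>
      γ.walk.getVert (min i k)) (Kr δ)) (𝓝[>] 0) (𝓝 0)

/-! ## 2. Registered stubs (sorried) -/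

/-- STUB 1 (open-problem size, the HEART): the field-free flow-line martingale property of the critical SAW
(`SAWDressingMartingale`). Why plausibly true: it is implied by the crux (defect comparison at `(k, F)` and
`(max |γ|, F ∘ (·)^k)`), and it is the lattice shadow of the IG-I martingale characterisation of the `κ = 8/3` flow
line; why it might fail: the crux's own risk (conjunct strength; no exact `ℤ²` identity; `√δ`-block winding bias). -/
theorem stub_sawDressingMartingale : SAWDressingMartingale := by
  sorry

/-- STUB 2 (L): martingale defect `→ 0` ⟹ well-dressing coupling with exact face-DGFF marginal
(`DressedCouplingUpgrade`). Why plausibly true: explicit dressed-mixture construction + Strassen coupling +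
Banach–Steinhaus (module docstring, steps (1)–(5)); why it might fail: step (4) (joint control of all test functions)
might need an a-priori local-`L¹` tightness of the winding dressing under `SAW.law`. -/
theorem stub_dressedCouplingUpgrade : DressedCouplingUpgrade := by
  sorry

/-! ### Name-keyed aliases of the stub statements (hypotheses of the composition)

The skeleton audit (`#h21_check_skeleton`) admits a hypothesis of the skeleton theorem only if its head constant is a
registered obligation or is NAMED like a declared stub; `__Registered.stub_X : Prop` is the statement of `stub_X` under
that name (device of `Cruxes/HarmonicIdentification/Lines/birth.lean`; the `__` namespace is an implementation detail,
so the audit's stub report resolves each `stub_…` to the sorried theorem). Each alias is `rfl`-equal to its statement. -/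
namespace __Registered

/-- Alias keyed by the registered stub name. -/
abbrev stub_sawDressingMartingale : Prop := SAWDressingMartingale
/-- Alias keyed by the registered stub name. -/
abbrev stub_dressedCouplingUpgrade : Prop := DressedCouplingUpgrade

end __Registered

/-! ## 3. The composition (kernel-checked, no `sorry`): the two stubs imply the crux BY NAME -/

/-- **`GaussianDressing_of`: SAWDressingMartingale → DressedCouplingUpgrade → `SAWDiscreteFlowLine.GaussianDressing`.**
Pointwise in `(D, a, b, φ)` the upgrade stub consumes the martingale stub; the result is the crux's body under the
crux's `let` telescope (definitional unfolding of the shared lets only). -/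
theorem GaussianDressing_of (h1 : __Registered.stub_sawDressingMartingale)
    (h2 : __Registered.stub_dressedCouplingUpgrade) :
    Summit.CriticalPhenomena.SAWScalingLimit.Theses.SAWDiscreteFlowLine.GaussianDressing := by
  intro D a b hab φ hφ
  exact h2 D a b hab φ hφ (h1 D a b hab φ hφ)

/-- Wiring check (hypothesis-free form): the crux modulo the two sorried stubs. -/
example : Summit.CriticalPhenomena.SAWScalingLimit.Theses.SAWDiscreteFlowLine.GaussianDressing :=
  GaussianDressing_of stub_sawDressingMartingale stub_dressedCouplingUpgrade

end Summit.CriticalPhenomena.SAWScalingLimit.Cruxes.GaussianDressing.Birth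

end
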